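import Summits.QuantumAdvantage.QuantumAdvantage.Theorems.InnerDegreeLawsE

set_option linter.dupNamespace false

/-!
# InnerDegreeLawsG (lens 4, g27; part G = LAND-PACKAGE-4) — the SATURATED regime of PatternRank: Fourier inversion on 𝔽_p in characteristic two, the character-matrix factorisation P = M·F, rank ≥ p^r for every non-constant table, and the saturated rectangle kill (third dense-compatible one-register instance decided)

Blocker `X = AbsorptionDial.NoPerfectPolyOdd` (item 28487); decomp-qadv lens 4 (minimal-counterexample / extremal reduction), g27.  The NODE record
(rung `QuadFormNoPerfectOdd`, residual `QuadLiftOdd`, sub-rung `OneQuadNoPerfectOdd`, floor `linFormFloor`, `x_iff_pieces`) lives in the cell file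
`g27/InnerDegreeDial.lean` and is NOT landed (Prop-definition node pieces); the tree parts are Prop-definition-free and state only unconditional LAWS.
Parts A–E are LANDED (p825604/p825613/p825616/p825666/p826280; LAW C/Q/E/S/C⁺, first-moment subcubes, deletion identity, normal form, LAW R);
part F (MOD_p / affine rectangle kills) is LAND-PACKAGE-3, part G is the LAND-PACKAGE-4 delta (imports part E only).  Kernel-checked content:

* §14 **the SATURATED theorem (`rank_satPat_ge`) and rectangle kill (`loss_of_saturatedRectangle`)** (NODE6): for every non-constant
  `f : 𝔽_p → K` the full inner-product pattern `[f(⟨v,w⟩)]_{v,w ∈ 𝔽_p^{r+1}}` has rank `≥ p^r` over any characteristic-two `K ∋ μ_p`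
  (Fourier inversion with `(p : K) = 1`, `P = M·F` with the character matrix `F` invertible, scalar `p^r`-submatrix of `M` on the line
  representatives `(1, a)`); hence a register `k`-form except `g₀`, with `g₀` live on a disjoint-support rectangle indexed by `𝔽_p^{r+1} × 𝔽_p^{r+1}`
  and firing as `G₀(⟨v,w⟩ + e)` (ANY non-constant table), loses somewhere once `p^r > (n+1)·2p^k + 1` — PatternRank in the saturated regime
  (subset-sum sets of the cross block's rank factorisation = all of `𝔽_p^{r+1}`, «twin-rich» dense registers), base `p`.
-/

open Finset
open Summit.QuantumAdvantage.AdviceFreeQNC0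

namespace Summit.QuantumAdvantage.QuantumAdvantage.Theorems.InnerDegreeDial

/-! ### §14 the SATURATED REGIME of PatternRank (NODE6 §3 (c0)(vi)): full inner-product patterns over `𝔽_p^{r+1}` have rank `≥ p^r`

For every non-constant `f : 𝔽_p → K` (`K` of characteristic two with a primitive `p`-th root of unity) the matrix `[f(⟨v,w⟩)]_{v,w ∈ 𝔽_p^{r+1}}`
has rank `≥ p^r`.  Proof: Fourier inversion on `𝔽_p` in `K` (`(p : K) = 1`, `fourier_inv`); the factorisation `P = M · F`
(`lineMat_mul_charMat`) with `F = [ψ(⟨v,w⟩)]` invertible (`F² = [w = −v]`, `isUnit_charMat_det`) and `M[v,u] = Σ_{s : s•v = u} f̂(s)`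
supported on the punctured lines; the representatives `(1, a)` of `p^r` distinct lines give the scalar submatrix `f̂(s₀) • 1` of `M`
(`lineMat_submatrix`), `f̂(s₀) ≠ 0` for some `s₀ ≠ 0` because `f` is non-constant (`exists_fcoef_ne_zero`).  The game corollary
`loss_of_saturatedRectangle` is the third dense-compatible instance of (c0) decided by LAW R. -/

section Saturated

variable {K : Type*} [Field K] [CharP K 2]
variable {p : ℕ} [Fact p.Prime]

/-- Fourier coefficient `f̂(s) = Σ_t f(t) ψ(−st)` of `f : 𝔽_p → K` for the additive character `ψ = ω^{·}` -/
noncomputable def fcoef {ω : K} (hω : IsPrimitiveRoot ω p) (f : ZMod p → K) (s : ZMod p) : K :=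
  ∑ t, f t * Coset21.CharTwoKill.chi ω hω (-(s * t))

/-- Fourier inversion on `𝔽_p` in characteristic two (`p` odd, so `(p : K) = 1`) -/
theorem fourier_inv (hp5 : 5 ≤ p) {ω : K} (hω : IsPrimitiveRoot ω p) (f : ZMod p → K) (t : ZMod p) :
    ∑ s, fcoef hω f s * Coset21.CharTwoKill.chi ω hω (s * t) = f t := by
  classical
  have key : ∀ t', ∑ s, Coset21.CharTwoKill.chi ω hω (-(s * t')) * Coset21.CharTwoKill.chi ω hω (s * t)
      = if t - t' = 0 then (1 : K) else 0 := by
    intro t'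
    rw [Coset21.CharTwoKill.indicator_eq_sum hp5 hω (t - t')]
    refine sum_congr rfl fun s _ => ?_
    rw [← AddChar.map_add_eq_mul]
    show Coset21.CharTwoKill.chi ω hω _ = Coset21.CharTwoKill.chi ω hω _
    congr 1; ring
  calc ∑ s, fcoef hω f s * Coset21.CharTwoKill.chi ω hω (s * t)
      = ∑ s, ∑ t', f t' * (Coset21.CharTwoKill.chi ω hω (-(s * t')) * Coset21.CharTwoKill.chi ω hω (s * t)) := by
        refine sum_congr rfl fun s _ => ?_
        rw [fcoef, sum_mul]
        refine sum_congr rfl fun t' _ => ?_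
        rw [mul_assoc]
    _ = ∑ t', f t' * ∑ s, Coset21.CharTwoKill.chi ω hω (-(s * t')) * Coset21.CharTwoKill.chi ω hω (s * t) := by
        rw [sum_comm]
        refine sum_congr rfl fun t' _ => ?_
        rw [mul_sum]
    _ = ∑ t', f t' * (if t - t' = 0 then (1 : K) else 0) := by
        refine sum_congr rfl fun t' _ => ?_
        rw [key]
    _ = f t := by
        simp_rw [sub_eq_zero, mul_ite, mul_one, mul_zero]
        rw [sum_ite_eq]
        simp

/-- a non-constant `f` has a nonzero Fourier coefficient at a nonzero frequency -/
theorem exists_fcoef_ne_zero (hp5 : 5 ≤ p) {ω : K} (hω : IsPrimitiveRoot ω p) (f : ZMod p → K) {a b : ZMod p}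
    (hab : f a ≠ f b) : ∃ s, s ≠ 0 ∧ fcoef hω f s ≠ 0 := by
  classical
  by_contra h
  have h' : ∀ s, s ≠ 0 → fcoef hω f s = 0 := fun s hs =>
    Classical.byContradiction fun hne => h ⟨s, hs, hne⟩
  have hconst : ∀ t, f t = fcoef hω f 0 := by
    intro t
    rw [← fourier_inv hp5 hω f t, sum_eq_single (0 : ZMod p)]
    · rw [zero_mul, AddChar.map_zero_eq_one, mul_one]
    · intro s _ hs
      rw [h' s hs, zero_mul]
    · intro h0
      exact absurd (mem_univ _) h0
  exact hab (by rw [hconst a, hconst b])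

/-- the character matrix `F[v,w] = ψ(⟨v,w⟩)` on `𝔽_p^r` -/
noncomputable def charMat {ω : K} (hω : IsPrimitiveRoot ω p) (r : ℕ) : Matrix (Fin r → ZMod p) (Fin r → ZMod p) K :=
  Matrix.of fun v w => Coset21.CharTwoKill.chi ω hω (v ⬝ᵥ w)

/-- the negation permutation matrix `N[v,w] = [w = -v]` -/
def negMat (K : Type*) [Zero K] [One K] (p r : ℕ) : Matrix (Fin r → ZMod p) (Fin r → ZMod p) K :=
  Matrix.of fun v w => if w = -v then 1 else 0

/-- character orthogonality in matrix form: `F · F = N` (as `(p : K) = 1`) -/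
theorem charMat_mul_charMat (hp5 : 5 ≤ p) {ω : K} (hω : IsPrimitiveRoot ω p) (r : ℕ) :
    charMat hω r * charMat hω r = negMat K p r := by
  classical
  ext v w
  rw [Matrix.mul_apply, negMat, Matrix.of_apply]
  have h1 : ∀ u : Fin r → ZMod p, charMat hω r v u * charMat hω r u w
      = ∏ i, Coset21.CharTwoKill.chi ω hω (u i * (v i + w i)) := by
    intro u
    rw [charMat, Matrix.of_apply, Matrix.of_apply, ← AddChar.map_add_eq_mul,
      ← Coset21.CharTwoKill.addChar_map_sum]
    show Coset21.CharTwoKill.chi ω hω _ = Coset21.CharTwoKill.chi ω hω _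
    congr 1
    rw [dotProduct, dotProduct, ← sum_add_distrib]
    refine sum_congr rfl fun i _ => ?_
    ring
  simp_rw [h1]
  rw [← Fintype.piFinset_univ, ← prod_univ_sum (fun _ => (univ : Finset (ZMod p)))
    (fun i t => Coset21.CharTwoKill.chi ω hω (t * (v i + w i)))]
  have h2 : ∀ i, ∑ t ∈ (univ : Finset (ZMod p)), Coset21.CharTwoKill.chi ω hω (t * (v i + w i))
      = if v i + w i = 0 then (1 : K) else 0 := by
    intro i
    rw [Coset21.CharTwoKill.indicator_eq_sum hp5 hω (v i + w i)]
    rfl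
  simp_rw [h2]
  rw [prod_boole]
  congr 1
  simp only [mem_univ, true_implies]
  rw [funext_iff]
  refine propext (forall_congr' fun i => ?_)
  rw [Pi.neg_apply, eq_neg_iff_add_eq_zero, add_comm]

omit [CharP K 2] in
/-- `N` is an involution -/
theorem negMat_mul_negMat (r : ℕ) : negMat K p r * negMat K p r = 1 := by
  classical
  ext v w
  rw [Matrix.mul_apply, Matrix.one_apply]
  simp only [negMat, Matrix.of_apply]
  rw [sum_eq_single (-v)]
  · simp only [neg_neg, if_true, one_mul]
    by_cases h : v = w
    · subst h; simp
    · rw [if_neg h, if_neg (Ne.symm h)]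
  · intro u _ hu
    rw [if_neg hu, zero_mul]
  · intro h
    exact absurd (mem_univ _) h

/-- the character matrix is invertible -/
theorem isUnit_charMat_det (hp5 : 5 ≤ p) {ω : K} (hω : IsPrimitiveRoot ω p) (r : ℕ) :
    IsUnit (charMat hω r).det := by
  classical
  refine Matrix.isUnit_det_of_right_inverse (B := charMat hω r * negMat K p r) ?_
  rw [← Matrix.mul_assoc, charMat_mul_charMat hp5 hω, negMat_mul_negMat]

/-- the line-block matrix `M[v,u] = Σ_{s : s•v = u} f̂(s)` -/
noncomputable def lineMat {ω : K} (hω : IsPrimitiveRoot ω p) (f : ZMod p → K) (r : ℕ) :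
    Matrix (Fin r → ZMod p) (Fin r → ZMod p) K :=
  Matrix.of fun v u => ∑ s : ZMod p, if s • v = u then fcoef hω f s else 0

/-- pattern matrix of the saturated regime: `[f(⟨v,w⟩)]_{v,w ∈ 𝔽_p^r}` -/
def satPat (f : ZMod p → K) (r : ℕ) : Matrix (Fin r → ZMod p) (Fin r → ZMod p) K :=
  Matrix.of fun v w => f (v ⬝ᵥ w)

/-- the factorisation `P = M · F` -/
theorem lineMat_mul_charMat (hp5 : 5 ≤ p) {ω : K} (hω : IsPrimitiveRoot ω p) (f : ZMod p → K) (r : ℕ) :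
    lineMat hω f r * charMat hω r = satPat f r := by
  classical
  ext v w
  rw [Matrix.mul_apply, satPat, Matrix.of_apply]
  have h1 : ∀ u, lineMat hω f r v u * charMat hω r u w
      = ∑ s, if s • v = u then fcoef hω f s * Coset21.CharTwoKill.chi ω hω (u ⬝ᵥ w) else 0 := by
    intro u
    rw [lineMat, Matrix.of_apply, charMat, Matrix.of_apply, sum_mul]
    refine sum_congr rfl fun s _ => ?_
    split_ifs
    · rfl
    · rw [zero_mul]
  simp_rw [h1]
  rw [sum_comm]
  have h2 : ∀ s : ZMod p, ∑ u : Fin r → ZMod p, (if s • v = u then fcoef hω f s * Coset21.CharTwoKill.chi ω hω (u ⬝ᵥ w) else 0)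
      = fcoef hω f s * Coset21.CharTwoKill.chi ω hω (s * (v ⬝ᵥ w)) := by
    intro s
    rw [sum_ite_eq]
    simp only [mem_univ, if_true, smul_dotProduct, smul_eq_mul]
  simp_rw [h2]
  exact fourier_inv hp5 hω f (v ⬝ᵥ w)

/-- representatives `(1, a)` of `p^r` distinct punctured lines of `𝔽_p^{r+1}` -/
def lineRep (p r : ℕ) (a : Fin r → ZMod p) : Fin (r + 1) → ZMod p := Fin.cons 1 a

omit [CharP K 2] in
/-- on the line representatives `(1, a)` (rows) and `s₀ • (1, a)` (columns) the line-block matrix is the scalar matrix `f̂(s₀) • 1` -/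
theorem lineMat_submatrix {ω : K} (hω : IsPrimitiveRoot ω p) (f : ZMod p → K) (r : ℕ) {s₀ : ZMod p} (hs₀ : s₀ ≠ 0) :
    (lineMat hω f (r + 1)).submatrix (lineRep p r) (fun a => s₀ • lineRep p r a)
      = fcoef hω f s₀ • (1 : Matrix (Fin r → ZMod p) (Fin r → ZMod p) K) := by
  classical
  ext a a'
  rw [Matrix.submatrix_apply, lineMat, Matrix.of_apply, Matrix.smul_apply, Matrix.one_apply, smul_eq_mul,
    sum_eq_single s₀]
  · by_cases h : a = a'
    · subst h; simp
    · rw [if_neg h, mul_zero, if_neg]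
      intro heq
      apply h
      have hinj : lineRep p r a = lineRep p r a' := smul_right_injective _ hs₀ heq
      funext i
      have := congrFun hinj i.succ
      simpa [lineRep] using this
  · intro s _ hs
    rw [if_neg]
    intro heq
    apply hs
    have := congrFun heq 0
    simpa [lineRep] using this
  · intro h
    exact absurd (mem_univ _) h

/-- **THE SATURATED THEOREM (NODE6 §3 (c0)(vi)).**  For every non-constant `f : 𝔽_p → K` (`K` of characteristic two with a primitive
`p`-th root of unity, `p ≥ 5`), the full inner-product pattern `[f(⟨v,w⟩)]_{v,w ∈ 𝔽_p^{r+1}}` has rank `≥ p^r`: PatternRank holds with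
base `p` in the saturated regime (subset-sum sets = all of `𝔽_p^{r+1}`), for every table and offset. -/
theorem rank_satPat_ge (hp5 : 5 ≤ p) {ω : K} (hω : IsPrimitiveRoot ω p) (f : ZMod p → K) {a b : ZMod p}
    (hab : f a ≠ f b) (r : ℕ) : p ^ r ≤ (satPat f (r + 1)).rank := by
  classical
  obtain ⟨s₀, hs₀, hc⟩ := exists_fcoef_ne_zero hp5 hω f hab
  rw [← lineMat_mul_charMat hp5 hω f (r + 1), Matrix.rank_mul_eq_left_of_isUnit_det _ _ (isUnit_charMat_det hp5 hω (r + 1))]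
  refine le_trans ?_ (Matrix.rank_submatrix_le (lineMat hω f (r + 1)) (lineRep p r) (fun a => s₀ • lineRep p r a))
  rw [lineMat_submatrix hω f r hs₀]
  have hu : IsUnit (fcoef hω f s₀ • (1 : Matrix (Fin r → ZMod p) (Fin r → ZMod p) K)) := by
    rw [Matrix.isUnit_iff_isUnit_det, Matrix.det_smul, Matrix.det_one, mul_one]
    exact (isUnit_iff_ne_zero.mpr hc).pow _
  rw [Matrix.rank_of_isUnit _ hu, Fintype.card_fun, ZMod.card, Fintype.card_fin]

variable {n : ℕ}

/-- **THE SATURATED RECTANGLE KILL (third dense-compatible instance of the face (c0), by LAW R; NODE6).**  Registers `k`-form except `g₀`;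
`g₀` live on a disjoint-support rectangle indexed by `v, w ∈ 𝔽_p^{r+1}` and firing as `G₀(⟨v,w⟩ + e)` for ANY non-constant table `G₀`;
then `p^r > (n+1)·2p^k + 1` forces a losing input.  REALISATION: one dense quadratic register whose cross block (w.r.t. a cut) has `r+1`
independent row types and column types, each occurring `p − 1` times with coefficient pattern making the subset-sum sets all of `𝔽_p^{r+1}`
(«twin-rich»), internal parts vanishing on the block, pads fixing the walk exponent. -/
theorem loss_of_saturatedRectangle (hp5 : 5 ≤ p) {k r : ℕ} (c : ℕ)
    (y : Fin (n + 1) → (Fin n → Bool) → Bool) (g₀ : Fin (n + 1))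
    (lam : Fin (n + 1) → Fin k → Fin n → ZMod p) (F : Fin (n + 1) → (Fin k → ZMod p) → Bool)
    (hF : ∀ g, g ≠ g₀ → ∀ u, y g u = F g (fun j => ∑ i, if u i = true then lam g j i else 0))
    (X Y : (Fin (r + 1) → ZMod p) → Fin n → Bool) (hd : ∀ v w l, ¬ (X v l = true ∧ Y w l = true))
    (G₀ : ZMod p → Bool) (e : ZMod p) {b₁ b₂ : ZMod p} (hG : G₀ b₁ ≠ G₀ b₂)
    (hpat : ∀ v w, y g₀ (bor (X v) (Y w)) = G₀ (v ⬝ᵥ w + e))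
    (hlive : ∀ v w, liveCut c (bor (X v) (Y w)) g₀ = true)
    (ht : (n + 1) * (p ^ k * 2) + 1 < p ^ r) :
    ∃ u, ringWinU c y u = false := by
  classical
  obtain ⟨hK, ω, -, hω, -⟩ := Coset21.exists_charTwo_roots p hp5
  haveI := hK
  refine loss_of_rectRank hp5 c y g₀ lam F hF X Y hd (lt_of_lt_of_le ht ?_)
  have hrect : rect (Kp p) (fun u => y g₀ u && liveCut c u g₀) X Y
      = satPat (fun t => if G₀ (t + e) = true then (1 : Kp p) else 0) (r + 1) := by
    ext v w
    rw [rect, Matrix.of_apply, satPat, Matrix.of_apply]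
    simp only [hpat v w, hlive v w, Bool.and_true]
  rw [hrect]
  refine rank_satPat_ge hp5 hω _ (a := b₁ - e) (b := b₂ - e) ?_ r
  simp only [sub_add_cancel]
  intro h
  apply hG
  cases h1 : G₀ b₁ <;> cases h2 : G₀ b₂ <;> simp_all

end Saturated

end Summit.QuantumAdvantage.QuantumAdvantage.Theorems.InnerDegreeDial
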